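import Summits.QuantumFields.YangMills.Theorems.LuscherReductionTraceDoorDefs
import Summits.QuantumFields.YangMills.Theorems.LuscherReductionRunningReductionTraceFormulaAveraging
import Summits.QuantumFields.YangMills.Theorems.LuscherReductionRunningReductionTraceFormulaKernel
import Summits.QuantumFields.YangMills.Theorems.LuscherReductionRunningReductionBOHandoverLabels
import Summits.QuantumFields.YangMills.Theorems.LuscherReductionTwistedTraceScalingTowerOfUniform
import Summits.QuantumFields.YangMills.Theorems.FemtoTransferGapRungW1upAlgebra
import Summits.QuantumFields.YangMills.Theorems.FemtoTransferGapPhysL2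
import HarnessLib


/-!
# `TwistedTraceScaling` (crux stmt-QuantumFields-20203, route `LuscherReduction`, skeleton «twolattice»):
# negative-side support II — the strong-coupling branch of the two-loop label and the kernel/trace sandwich
# (refuter crux-disprover seat; this file does NOT refute the crux)

HONEST FRAMING: `TwistedTraceScaling` is a femto-rung (R2b1) crux of a CONDITIONAL reduction route; nothing here is a
mass-gap or Clay statement.  All objects are the tree's: `TT.physTraceSucc`, `TT.physTrace`, `TraceDoor.traceRatio`,
`luscherLambda`, `invRunningCoupling`, `transferKernel`, `timeCoupling`, `wilsonAction`, `physAvg`.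

Mechanism (used by `FalseWithoutBetaGeOne`).  The window `InFemtoWindow lam β L := 1 ≤ β ∧ lam ≤ Λ(β,L) ∧ Λ(β,L) ≤ 2·lam` locates
`β` through the two-loop label `1/ḡ²(β,L) = β/2 − 2b₀ log L + (b₁/b₀) log(2b₀/β)` (`BOHandover.invRunningCoupling_eq`).  As `β → 0⁺`
the last term tends to `+∞`, so every label value `v ≥ 1` — in particular every depth `Λ = lam ∈ (0, 1]` — is ALSO attained on a
strong-coupling branch `0 < β ≤ 2b₀e^{−(b₀/b₁)(v − 1/2)} < 1` (§1).  On that branch the transfer kernel is uniformly close to `1`: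
`e^{−cβ} ≤ K_β ≤ e^{cβ}` pointwise with `c = 2|E| + 4|P|` (§2, from `|Re tr U| ≤ 2` on `SU(2)`), hence
`e^{−cβ(n+1)} ≤ physTraceSucc L β n ≤ e^{cβ(n+1)}` and `traceRatio L β T ≥ e^{−4cβT} ≥ 1 − 4cβT` (§3).

Sorry-free content (standard axioms only):

* §1 `exists_strong_matched`, `exists_strong_window`: strong-coupling roots of the label / window equation on every lattice size
  (IVT on `[β_s, 1]`, continuity from `Tower.continuousOn_invRunningCoupling`).
* §2 `abs_timeCoupling_le`, `wilsonAction_su2_mem`, `transferKernel_sandwich`: elementary pointwise bounds (the constant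
  `2|E| + 4|P|` is always spelled out; no definition is introduced).
* §3 `le_physAvg` (a physical average of a measurable function bounded below by `m` and absolutely bounded is `≥ m`),
  `physTraceSucc_sandwich` (the cyclic product of `n+1` kernels under the product Haar probability measure inherits the pointwise
  sandwich), `one_sub_le_traceRatio` (`traceRatio L β T ≥ 1 − 4·(2|E|+4|P|)·β·T` for `β ≥ 0`, `T ≥ 1`).

Moral for provers: the window's `1 ≤ β` is exactly what excludes this branch (`Base.invRunningCoupling_ge'`-type monotonicity holds
only on `β ≥ 1`); see `FalseWithoutBetaGeOne` for the resulting failure of the crux without `1 ≤ β`.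
-/


set_option autoImplicit false

noncomputable section

open MeasureTheory Filter Topology Real
open Literature.MathematicalPhysics.QuantumFieldTheory hiding SU2
open Literature.MathematicalPhysics.QuantumLattice
open Literature.Analysis.OperatorTheory.YMMatrixModel
open scoped BigOperators

namespace Summit.QuantumFields.YangMills.Theorems.TwistedTraceScaling.Negative

open Summit.QuantumFields.YangMills.Theorems.FemtoTransferGap
open Summit.QuantumFields.YangMills.Theorems.FemtoTransferGap.TraceDoor
open Summit.QuantumFields.YangMills.Theorems.FemtoTransferGap.TT
open Summit.QuantumFields.YangMills.Theorems.FemtoTransferGap.TwoLattice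

/-! ## §1 The strong-coupling branch of the two-loop label -/

/-- **Strong-coupling solutions of the label equation.**  Every label value `v ≥ 1` is ALSO attained at some `0 < β < 1`, indeed at a
`β ≤ 2b₀ e^{−(b₀/b₁)(v − 1/2)}` (superexponentially small in `v`): the term `(b₁/b₀) log(2b₀/β)` of `1/ḡ²(β,L)` blows up as `β → 0⁺`.
So without `1 ≤ β` the window equation `Λ(β, L) = lam` has a second, strong-coupling root. [folklore] -/
theorem exists_strong_matched (L : ℕ) [NeZero L] {v : ℝ} (hv : 1 ≤ v) :
    ∃ β : ℝ, 0 < β ∧ β < 1 ∧ β ≤ 2 * b0 * Real.exp (-(b0 / b1) * (v - 1 / 2)) ∧ invRunningCoupling β L = v := by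
  have hb0 : 0 < b0 := by unfold b0; positivity
  have hb1 : 0 < b1 := by unfold b1; positivity
  have hlogL : 0 ≤ Real.log (L : ℝ) := Real.log_nonneg (by exact_mod_cast NeZero.one_le)
  have hw : 0 ≤ 2 * b0 * Real.log (L : ℝ) := by positivity
  set w : ℝ := 2 * b0 * Real.log (L : ℝ) with hwdef
  set βs : ℝ := 2 * b0 * Real.exp (-(b0 / b1) * (v + w)) with hβs
  have hβs0 : 0 < βs := by positivity
  have hE : Real.exp (-(b0 / b1) * (v + w)) * Real.exp ((b0 / b1) * (v + w)) = 1 := by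
    rw [← Real.exp_add, neg_mul, neg_add_cancel, Real.exp_zero]
  have hβs1 : βs ≤ 1 := by
    have h1 : Real.exp (-(b0 / b1) * (v + w)) ≤ 1 := Real.exp_le_one_iff.mpr (by
      have : 0 ≤ (b0 / b1) * (v + w) := by positivity
      linarith)
    calc βs ≤ 2 * b0 * 1 := mul_le_mul_of_nonneg_left h1 (by positivity)
      _ ≤ 1 := by linarith [BOHandover.two_mul_b0_le_one]
  have hquot : 2 * b0 / βs = Real.exp ((b0 / b1) * (v + w)) := by
    have hm : βs * Real.exp ((b0 / b1) * (v + w)) = 2 * b0 := by rw [hβs, mul_assoc, hE, mul_one]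
    rw [div_eq_iff hβs0.ne']
    linarith [hm]
  have hval_s : v ≤ invRunningCoupling βs L := by
    rw [BOHandover.invRunningCoupling_eq, hquot, Real.log_exp]
    have : (b1 / b0) * ((b0 / b1) * (v + w)) = v + w := by field_simp
    rw [← hwdef, this]; linarith
  have hval_1 : invRunningCoupling 1 L ≤ v := (BOHandover.invRunningCoupling_le_half le_rfl L).trans (by linarith)
  have hcont := Tower.continuousOn_invRunningCoupling L (b := (1 : ℝ)) hβs0
  obtain ⟨β, hmem, hβv⟩ := intermediate_value_Icc' hβs1 hcont ⟨hval_1, hval_s⟩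
  simp only at hβv
  have hβ0 : 0 < β := lt_of_lt_of_le hβs0 hmem.1
  have hβ1 : β < 1 := by
    rcases lt_or_eq_of_le hmem.2 with h | h
    · exact h
    · exfalso
      rw [h] at hβv
      have := BOHandover.invRunningCoupling_le_half (le_refl (1 : ℝ)) L
      linarith
  refine ⟨β, hβ0, hβ1, ?_, hβv⟩
  have heq := hβv
  rw [BOHandover.invRunningCoupling_eq, ← hwdef] at heq
  have h1 : v - 1 / 2 ≤ (b1 / b0) * Real.log (2 * b0 / β) := by linarith [hmem.2]
  have hlog_ge : (b0 / b1) * (v - 1 / 2) ≤ Real.log (2 * b0 / β) := by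
    have h2 : Real.log (2 * b0 / β) = (b0 / b1) * ((b1 / b0) * Real.log (2 * b0 / β)) := by field_simp
    rw [h2]
    exact mul_le_mul_of_nonneg_left h1 (by positivity)
  have h3 : Real.exp ((b0 / b1) * (v - 1 / 2)) ≤ 2 * b0 / β := by
    have := Real.exp_le_exp.mpr hlog_ge
    rwa [Real.exp_log (by positivity)] at this
  rw [le_div_iff₀ hβ0] at h3
  have h4 : Real.exp (-(b0 / b1) * (v - 1 / 2)) * Real.exp ((b0 / b1) * (v - 1 / 2)) = 1 := by
    rw [← Real.exp_add, neg_mul, neg_add_cancel, Real.exp_zero]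
  calc β = β * (Real.exp (-(b0 / b1) * (v - 1 / 2)) * Real.exp ((b0 / b1) * (v - 1 / 2))) := by rw [h4, mul_one]
    _ = Real.exp (-(b0 / b1) * (v - 1 / 2)) * (Real.exp ((b0 / b1) * (v - 1 / 2)) * β) := by ring
    _ ≤ Real.exp (-(b0 / b1) * (v - 1 / 2)) * (2 * b0) := mul_le_mul_of_nonneg_left h3 (Real.exp_pos _).le
    _ = 2 * b0 * Real.exp (-(b0 / b1) * (v - 1 / 2)) := by ring

/-- Without `1 ≤ β` the window inequalities `lam ≤ Λ(β,L) ≤ 2 lam` are met on the STRONG-coupling branch too: for `0 < lam ≤ 1` some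
`0 < β < 1` with `β ≤ 2b₀ e^{b₀/(2b₁)} e^{−(b₀/b₁)/lam³}` has `Λ(β, L) = lam` exactly. [folklore] -/
theorem exists_strong_window (L : ℕ) [NeZero L] {lam : ℝ} (h0 : 0 < lam) (h1 : lam ≤ 1) :
    ∃ β : ℝ, 0 < β ∧ β < 1 ∧ β ≤ 2 * b0 * Real.exp (-(b0 / b1) * (1 / lam ^ 3 - 1 / 2)) ∧ luscherLambda β L = lam := by
  have hv : (1 : ℝ) ≤ 1 / lam ^ 3 := by
    rw [le_div_iff₀ (by positivity)]
    have : lam ^ 3 ≤ 1 := pow_le_one₀ h0.le h1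
    linarith
  obtain ⟨β, hβ0, hβ1, hβle, hval⟩ := exists_strong_matched L hv
  have hvpos : 0 < invRunningCoupling β L := by rw [hval]; positivity
  have h3 : luscherLambda β L ^ 3 = lam ^ 3 := by
    rw [BOHandover.luscherLambda_pow_three hvpos, hval, one_div, inv_inv]
  have hnn : 0 ≤ luscherLambda β L := by
    unfold luscherLambda; exact Real.rpow_nonneg (le_max_right _ _) _
  exact ⟨β, hβ0, hβ1, hβle, (pow_left_inj₀ hnn h0.le (by norm_num : (3 : ℕ) ≠ 0)).1 h3⟩

/-! ## §2 Pointwise kernel sandwich `e^{−c_L β} ≤ K_β ≤ e^{c_L β}`, `c_L = 2|E| + 4|P|` -/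

/-- `|timeCoupling| ≤ 2|E|` (`|Re tr W| ≤ 2` on `SU(2)`). [folklore] -/
theorem abs_timeCoupling_le {L : ℕ} [NeZero L] (U V : GaugeConfig 3 L SU2) :
    |timeCoupling su2Rep U V| ≤ 2 * (Fintype.card (Edge 3 L) : ℝ) := by
  unfold timeCoupling
  rw [abs_le]
  constructor
  · calc -(2 * (Fintype.card (Edge 3 L) : ℝ)) = ∑ _e : Edge 3 L, (-2 : ℝ) := by
          rw [Finset.sum_const, Finset.card_univ, nsmul_eq_mul]; ring
      _ ≤ _ := Finset.sum_le_sum fun e _ => by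
          have h := neg_two_le_re_trace (U e * (V e)⁻¹)
          simp only [fundamentalRep_apply]
          exact h
  · calc _ ≤ ∑ _e : Edge 3 L, (2 : ℝ) := Finset.sum_le_sum fun e _ => by
          have h := re_trace_le_two (U e * (V e)⁻¹)
          simp only [fundamentalRep_apply]
          exact h
      _ = _ := by rw [Finset.sum_const, Finset.card_univ, nsmul_eq_mul]; ring

/-- `0 ≤ S(U) ≤ 4|P|` for the `SU(2)` Wilson action. [folklore] -/
theorem wilsonAction_su2_mem {L : ℕ} [NeZero L] (U : GaugeConfig 3 L SU2) :
    0 ≤ wilsonAction su2Rep U ∧ wilsonAction su2Rep U ≤ 4 * (Fintype.card (Plaquette 3 L) : ℝ) := by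
  unfold wilsonAction
  constructor
  · refine Finset.sum_nonneg fun p _ => ?_
    have h := re_trace_le_two (plaquetteHolonomy U p.1 p.2.1.1 p.2.1.2)
    simp only [fundamentalRep_apply, Nat.cast_ofNat]
    linarith
  · calc _ ≤ ∑ _p : Plaquette 3 L, (4 : ℝ) := Finset.sum_le_sum fun p _ => by
          have h := neg_two_le_re_trace (plaquetteHolonomy U p.1 p.2.1.1 p.2.1.2)
          simp only [fundamentalRep_apply, Nat.cast_ofNat]
          linarith
      _ = _ := by rw [Finset.sum_const, Finset.card_univ, nsmul_eq_mul]; ring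

/-- **Kernel sandwich**: `e^{−(2|E|+4|P|)β} ≤ K_β(U,V) ≤ e^{(2|E|+4|P|)β}` for `β ≥ 0`. [folklore] -/
theorem transferKernel_sandwich {L : ℕ} [NeZero L] {β : ℝ} (hβ : 0 ≤ β) (U V : GaugeConfig 3 L SU2) :
    Real.exp (-((2 * (Fintype.card (Edge 3 L) : ℝ) + 4 * (Fintype.card (Plaquette 3 L) : ℝ)) * β)) ≤ transferKernel su2Rep β U V ∧
      transferKernel su2Rep β U V ≤ Real.exp ((2 * (Fintype.card (Edge 3 L) : ℝ) + 4 * (Fintype.card (Plaquette 3 L) : ℝ)) * β) := by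
  have ht := abs_le.mp (abs_timeCoupling_le U V)
  have hU := wilsonAction_su2_mem U
  have hV := wilsonAction_su2_mem V
  unfold transferKernel
  constructor
  · refine Real.exp_le_exp.mpr ?_
    nlinarith [ht.1, hU.2, hV.2]
  · refine Real.exp_le_exp.mpr ?_
    nlinarith [ht.2, hU.1, hV.1]

/-! ## §3 Trace sandwich and the strong-coupling value of the trace ratio -/

/-- Lower bound for the physical average: `m ≤ f` pointwise (with `f` bounded measurable) gives `m ≤ P f`. [folklore] -/
theorem le_physAvg {L : ℕ} [NeZero L] {f : GaugeConfig 3 L SU2 → ℝ} (hf : Measurable f) {m C : ℝ} (hm : ∀ U, m ≤ f U)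
    (hC : ∀ U, |f U| ≤ C) (U : GaugeConfig 3 L SU2) : m ≤ physAvg f U := by
  haveI := isProbabilityMeasure_gaugeMeasure (L := L)
  have h1 : ∀ z : Fin 3 → Bool, m ≤ ∫ g, f (gaugeTransform g (twist3 z U)) ∂gaugeMeasure L := fun z => by
    have h2 : Measurable (fun g : Site 3 L → SU2 => (U, g)) := measurable_prodMk_left
    have hsm : StronglyMeasurable ((Function.uncurry fun (U : GaugeConfig 3 L SU2) (g : Site 3 L → SU2) =>
        f (gaugeTransform g (twist3 z U))) ∘ (fun g : Site 3 L → SU2 => (U, g))) :=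
      (stronglyMeasurable_act_swap (L := L) hf z).comp_measurable h2
    have hint : Integrable (fun g : Site 3 L → SU2 => f (gaugeTransform g (twist3 z U))) (gaugeMeasure L) :=
      Integrable.of_bound hsm.aestronglyMeasurable C (ae_of_all _ fun g => by rw [Real.norm_eq_abs]; exact hC _)
    calc m = ∫ _g : Site 3 L → SU2, m ∂gaugeMeasure L := by simp
      _ ≤ _ := integral_mono (integrable_const m) hint fun g => hm _
  have h2 : (8 : ℝ) * m ≤ ∑ z : Fin 3 → Bool, ∫ g, f (gaugeTransform g (twist3 z U)) ∂gaugeMeasure L :=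
    calc (8 : ℝ) * m = ∑ _z : Fin 3 → Bool, m := by simp
      _ ≤ _ := Finset.sum_le_sum fun z _ => h1 z
  unfold physAvg
  linarith

/-- **Trace sandwich**: `e^{−c_L β (n+1)} ≤ Z_phys(L, β, n+1) ≤ e^{c_L β (n+1)}` (`β ≥ 0`; the a-priori measure is a probability). [folklore] -/
theorem physTraceSucc_sandwich (L : ℕ) [NeZero L] {β : ℝ} (hβ : 0 ≤ β) (n : ℕ) :
    Real.exp (-((2 * (Fintype.card (Edge 3 L) : ℝ) + 4 * (Fintype.card (Plaquette 3 L) : ℝ)) * β)) ^ (n + 1) ≤ physTraceSucc L β n ∧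
      physTraceSucc L β n ≤ Real.exp ((2 * (Fintype.card (Edge 3 L) : ℝ) + 4 * (Fintype.card (Plaquette 3 L) : ℝ)) * β) ^ (n + 1) := by
  set c : ℝ := (2 * (Fintype.card (Edge 3 L) : ℝ) + 4 * (Fintype.card (Plaquette 3 L) : ℝ)) * β with hc
  set a : ℝ := Real.exp (-c) with ha
  set A : ℝ := Real.exp c with hA
  have ha0 : 0 < a := Real.exp_pos _
  have hK : ∀ U V : GaugeConfig 3 L SU2, a ≤ transferKernel su2Rep β U V ∧ transferKernel su2Rep β U V ≤ A :=
    fun U V => transferKernel_sandwich hβ U V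
  have hKabs : ∀ U V : GaugeConfig 3 L SU2, |transferKernel su2Rep β U V| ≤ A := fun U V => by
    rw [abs_of_pos (transferKernel_pos _ _ _ _)]; exact (hK U V).2
  have hPlo : ∀ U V : GaugeConfig 3 L SU2, a ≤ physAvg (transferKernel su2Rep β U) V := fun U V =>
    le_physAvg (measurable_transferKernel_right β U) (fun V => (hK U V).1) (hKabs U) V
  have hPhi : ∀ U V : GaugeConfig 3 L SU2, physAvg (transferKernel su2Rep β U) V ≤ A := fun U V =>
    (le_abs_self _).trans (abs_physAvg_le (hKabs U) V)
  obtain ⟨F, hF⟩ : ∃ F : (Fin (n + 1) → GaugeConfig 3 L SU2) → ℝ, F = fun Us =>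
      (∏ i : Fin n, transferKernel su2Rep β (Us i.castSucc) (Us i.succ)) *
        physAvg (transferKernel su2Rep β (Us (Fin.last n))) (Us 0) := ⟨_, rfl⟩
  have hπ : ∀ j : Fin (n + 1), Measurable fun Us : Fin (n + 1) → GaugeConfig 3 L SU2 => Us j :=
    fun j => measurable_pi_apply j
  have hprod_nn : ∀ Us : Fin (n + 1) → GaugeConfig 3 L SU2,
      0 ≤ ∏ i : Fin n, transferKernel su2Rep β (Us i.castSucc) (Us i.succ) := fun Us =>
    Finset.prod_nonneg fun i _ => (transferKernel_pos _ _ _ _).le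
  have hFlo : ∀ Us, a ^ (n + 1) ≤ F Us := fun Us => by
    rw [hF]
    have hp : a ^ n ≤ ∏ i : Fin n, transferKernel su2Rep β (Us i.castSucc) (Us i.succ) :=
      calc a ^ n = ∏ _i : Fin n, a := by simp
        _ ≤ _ := Finset.prod_le_prod (fun _ _ => ha0.le) fun i _ => (hK _ _).1
    calc a ^ (n + 1) = a ^ n * a := pow_succ a n
      _ ≤ _ := mul_le_mul hp (hPlo _ _) ha0.le (hprod_nn Us)
  have hFhi : ∀ Us, F Us ≤ A ^ (n + 1) := fun Us => by
    rw [hF]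
    have hp : ∏ i : Fin n, transferKernel su2Rep β (Us i.castSucc) (Us i.succ) ≤ A ^ n :=
      calc ∏ i : Fin n, transferKernel su2Rep β (Us i.castSucc) (Us i.succ) ≤ ∏ _i : Fin n, A :=
            Finset.prod_le_prod (fun i _ => (transferKernel_pos _ _ _ _).le) fun i _ => (hK _ _).2
        _ = A ^ n := by simp
    calc _ ≤ A ^ n * A := mul_le_mul hp (hPhi _ _) (ha0.le.trans (hPlo _ _)) (pow_nonneg (Real.exp_pos _).le n)
      _ = A ^ (n + 1) := (pow_succ A n).symm
  have hKm : Measurable fun p : GaugeConfig 3 L SU2 × GaugeConfig 3 L SU2 => transferKernel su2Rep β p.1 p.2 :=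
    (PhysL2.stronglyMeasurable_transferKernel (L := L) β).measurable
  have hPm : Measurable fun p : GaugeConfig 3 L SU2 × GaugeConfig 3 L SU2 => physKernel β p.1 p.2 :=
    (stronglyMeasurable_physKernel (L := L) β).measurable
  have hKi : ∀ i : Fin n, Measurable fun Us : Fin (n + 1) → GaugeConfig 3 L SU2 =>
      transferKernel su2Rep β (Us i.castSucc) (Us i.succ) := fun i => by
    have h3 : Measurable ((fun p : GaugeConfig 3 L SU2 × GaugeConfig 3 L SU2 => transferKernel su2Rep β p.1 p.2) ∘
        fun Us : Fin (n + 1) → GaugeConfig 3 L SU2 => (Us i.castSucc, Us i.succ)) := hKm.comp ((hπ _).prodMk (hπ _))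
    exact h3
  have hprod : Measurable fun Us : Fin (n + 1) → GaugeConfig 3 L SU2 =>
      ∏ i : Fin n, transferKernel su2Rep β (Us i.castSucc) (Us i.succ) :=
    Finset.measurable_prod _ fun i _ => hKi i
  have hlast : Measurable fun Us : Fin (n + 1) → GaugeConfig 3 L SU2 =>
      physAvg (transferKernel su2Rep β (Us (Fin.last n))) (Us 0) := by
    have h3 : Measurable ((fun p : GaugeConfig 3 L SU2 × GaugeConfig 3 L SU2 => physKernel β p.1 p.2) ∘
        fun Us : Fin (n + 1) → GaugeConfig 3 L SU2 => (Us (Fin.last n), Us 0)) := hPm.comp ((hπ _).prodMk (hπ 0))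
    exact h3
  have hFm : Measurable F := by
    rw [hF]; exact hprod.mul hlast
  have hFi : Integrable F (Measure.pi fun _ : Fin (n + 1) => configMeasure SU2 L) :=
    Integrable.of_bound hFm.aestronglyMeasurable (A ^ (n + 1)) (ae_of_all _ fun Us => by
      rw [Real.norm_eq_abs, abs_of_nonneg ((pow_pos ha0 _).le.trans (hFlo Us))]; exact hFhi Us)
  have hdef : physTraceSucc L β n = ∫ Us, F Us ∂(Measure.pi fun _ : Fin (n + 1) => configMeasure SU2 L) := by
    rw [hF]; rfl
  rw [hdef]
  constructor
  · calc a ^ (n + 1) = ∫ _Us, a ^ (n + 1) ∂(Measure.pi fun _ : Fin (n + 1) => configMeasure SU2 L) := by simp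
      _ ≤ _ := integral_mono (integrable_const _) hFi hFlo
  · calc ∫ Us, F Us ∂(Measure.pi fun _ : Fin (n + 1) => configMeasure SU2 L)
        ≤ ∫ _Us, A ^ (n + 1) ∂(Measure.pi fun _ : Fin (n + 1) => configMeasure SU2 L) := integral_mono hFi (integrable_const _) hFhi
      _ = A ^ (n + 1) := by simp

/-- **The trace ratio at weak `β`-coupling (strong bare coupling) is close to `1`**: `traceRatio L β T ≥ 1 − 4 c_L β T` for `β ≥ 0`, `T ≥ 1`
(`Z(2T) ≥ e^{−2c_LβT}`, `Z(T) ≤ e^{c_LβT}`). [folklore] -/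
theorem one_sub_le_traceRatio (L : ℕ) [NeZero L] {β : ℝ} (hβ : 0 ≤ β) {T : ℕ} (hT : 1 ≤ T) :
    1 - 4 * ((2 * (Fintype.card (Edge 3 L) : ℝ) + 4 * (Fintype.card (Plaquette 3 L) : ℝ)) * β) * T ≤ traceRatio L β T := by
  set c : ℝ := (2 * (Fintype.card (Edge 3 L) : ℝ) + 4 * (Fintype.card (Plaquette 3 L) : ℝ)) * β with hc
  have h2 := (physTraceSucc_sandwich L hβ (2 * T - 1)).1
  have h1 := (physTraceSucc_sandwich L hβ (T - 1)).2
  have h1lo := (physTraceSucc_sandwich L hβ (T - 1)).1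
  have e2 : 2 * T - 1 + 1 = 2 * T := by omega
  have e1 : T - 1 + 1 = T := by omega
  rw [e2] at h2
  rw [e1] at h1 h1lo
  have hZT : 0 < physTraceSucc L β (T - 1) := lt_of_lt_of_le (pow_pos (Real.exp_pos _) _) h1lo
  unfold traceRatio physTrace
  -- `exp(-c)^(2T) / (exp(c)^T)^2 = exp(-4cT) ≥ 1 - 4cT`
  have hlow : Real.exp (-c) ^ (2 * T) / (Real.exp c ^ T) ^ 2 ≤
      physTraceSucc L β (2 * T - 1) / physTraceSucc L β (T - 1) ^ 2 := by
    rw [div_le_div_iff₀ (by positivity) (by positivity)]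
    calc Real.exp (-c) ^ (2 * T) * physTraceSucc L β (T - 1) ^ 2
        ≤ Real.exp (-c) ^ (2 * T) * (Real.exp c ^ T) ^ 2 :=
          mul_le_mul_of_nonneg_left (pow_le_pow_left₀ hZT.le h1 2) (by positivity)
      _ ≤ physTraceSucc L β (2 * T - 1) * (Real.exp c ^ T) ^ 2 := mul_le_mul_of_nonneg_right h2 (by positivity)
  have hexp : Real.exp (-c) ^ (2 * T) / (Real.exp c ^ T) ^ 2 = Real.exp (-(4 * c * T)) := by
    rw [← Real.exp_nat_mul, ← pow_mul, ← Real.exp_nat_mul, ← Real.exp_sub]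
    congr 1; push_cast; ring
  have hlin : 1 - 4 * c * T ≤ Real.exp (-(4 * c * T)) := by
    have := Real.add_one_le_exp (-(4 * c * T)); linarith
  linarith [hlow, hexp ▸ hlin]

end Summit.QuantumFields.YangMills.Theorems.TwistedTraceScaling.Negative

end
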